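import Literature.AlgebraicGeometry.DuqueFrancoVillaflor2025.JoinArtinianGorenstein
import Literature.AlgebraicGeometry.DuqueFrancoVillaflor2025.JoinHilbertFunction
import Mathlib.LinearAlgebra.PerfectPairing.Basic
import HarnessLib

/-!
# The Hilbert function of a join is the convolution — ideal form (Duque Franco–Villaflor 2025, Cor. 6.1)

J. Duque Franco, R. Villaflor Loyola, *Periods of join algebraic cycles*, Ann. Sc. Norm. Super. Pisa Cl. Sci.
(2025) = arXiv:2312.17222 [DuqueFrancoVillaflor2025Join] (text read: arXiv version, p. 17):

> **Definition 6.1.** […] For every `λ ∈ H^{n/2,n/2}(X,ℚ)`, its associated Hilbert function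
> `HF_λ : ℤ_{≥0} → ℤ_{≥0}` is the Hilbert function of its associated Artinian Gorenstein algebra `R^{F,λ}`.
>
> **Corollary 6.1.** In the same context of (Thm. 1.1) we have `HF_{[J(Z₁,Z₂)]} = HF_{[Z₁]} * HF_{[Z₂]}`, this
> means that for all `k ≥ 0`, `HF_{[J(Z₁,Z₂)]}(k) = Σ_{p+q=k} HF_{[Z₁]}(p)·HF_{[Z₂]}(q)`.
> *Proof.* This follows from (Thm. 1.1). □

By Theorem 1.1 (tree file `JoinArtinianGorenstein.lean`: `R^{f+g,[J(Z₁,Z₂)]} = R^{f,[Z₁]} ⊗ R^{g,[Z₂]}`, i.e.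
`Ann(ℓ₁ ⊗ ℓ₂) = Ann ℓ₁·S + Ann ℓ₂·S`) the corollary is the statement that the Hilbert function of
`S/(I₁·S + I₂·S) = K[x]/I₁ ⊗ K[y]/I₂` is the convolution of the Hilbert functions of the factors. The tree file
`JoinHilbertFunction.lean` has the combinatorial layer (`conv`, and `finrank_joinPiece`: the degree-`k` piece of a
tensor product of graded spaces has dimension the convolution). **This file proves the statement about the
ideals themselves** (any field `K`, finitely many variables): for functionals `ℓ₁ : K[x_σ] → K`, `ℓ₂ : K[y_τ] → K`
concentrated in degrees `t₁`, `t₂`, with `I_j = Ann ℓ_j`, `I = Ann(ℓ₁ ⊗ ℓ₂) = I₁·S + I₂·S` and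
`h_J(k) = dim S_k − dim J_k`:

* **`hilbert_annIdeal_tensorFunctional`**: `h_I(k) = Σ_{p+q=k} h_{I₁}(p)·h_{I₂}(q) = conv h_{I₁} h_{I₂} k`;
* **`IsArtinianGorenstein.hilbert_join`**: the same for Artinian Gorenstein ideals `I₁ ⊆ K[x]`, `I₂ ⊆ K[y]`
  (Cor. 6.1 with `I₁ = J^{f,[Z₁]}`, `I₂ = J^{g,[Z₂]}`, `I₁·S + I₂·S = J^{f+g,[J(Z₁,Z₂)]}` by Thm. 1.1);
* **`annIdeal_eq_map_sup_map_iff`**: Thm. 1.1's second part as an EQUIVALENCE in algebraic form —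
  for `ℓ ≠ 0` concentrated in degree `t₁ + t₂`: `Ann ℓ = Ann ℓ₁·S + Ann ℓ₂·S ⟺ ℓ = c·(ℓ₁ ⊗ ℓ₂)`, `c ≠ 0`
  (via the uniqueness of the inverse-system generator, tree `annIdeal_eq_annIdeal_iff_exists_smul`);
* the tool, **`exists_graded_dual_families`**: for `ℓ` concentrated in degree `t` and `a + b = t`, lifts
  `u_i ∈ S_a`, `v_i ∈ S_b` (`i < h(a)`) of dual bases of the perfect pairing `(S/I)_a × (S/I)_b → K`:
  `ℓ(u_i v_j) = δ_{ij}` and `w ≡ Σ_i ℓ(u_i w)·v_i (mod I)` for every form `w` of degree `b` (Def. 2.1 (iii)).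

Proof of the count (in place of "This follows from Thm. 1.1"): the functional
`Ψ : S_k → K^{N}`, `g ↦ ((ℓ₁ ⊗ ℓ₂)(g · v¹_{p,i}(x) · v²_{q,j}(y)))_{p+q=k, i<h₁(p), j<h₂(q)}` is surjective (it maps
`u¹_{p,i}(x)u²_{q,j}(y)` to the standard basis, by `(ℓ₁ ⊗ ℓ₂)(p(x)q(y)) = ℓ₁(p)ℓ₂(q)` and degree reasons) and
its kernel is exactly `I_k` (the `v`-families span the complementary degrees modulo `I₁`, `I₂`), so
`dim S_k − dim I_k = N = Σ_{p+q=k} h₁(p)h₂(q)`.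
HONEST FRAMING (cell pub-hlocus): certified instances and evidence bearing on the general Hodge conjecture; no
claim.
-/

noncomputable section

open MvPolynomial Module Literature.RingTheory.MvPolynomial Literature.AlgebraicGeometry.Kloosterman2025

namespace Literature.AlgebraicGeometry.DuqueFrancoVillaflor2025

/-! ## Graded dual families of the perfect pairing `(S/I)_a × (S/I)_b → K` -/

section GradedDual

variable {K : Type*} [Field K] {σ : Type*} {t : ℕ} {ℓ : MvPolynomial σ K →ₗ[K] K}

/-- **Dual bases of the perfect pairing `R_a × R_b → R_t ≅ K`** (`R = S/Ann(ℓ)`, `a + b = t`, Def. 2.1 (iii)),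
lifted to forms: there are forms `u_1,…,u_n` of degree `a` and `v_1,…,v_n` of degree `b`, `n = h(a) =
dim S_a − dim I_a`, with `ℓ(u_i v_j) = δ_{ij}` and such that every form `w` of degree `b` satisfies
`w ≡ Σ_i ℓ(u_i w)·v_i (mod Ann ℓ)`. [cite: DuqueFrancoVillaflor2025Join, Definition 2.1 (iii)]
[cite: Kloosterman2025, Lemma 2.1] -/
theorem exists_graded_dual_families [Finite σ] (hℓ : ∀ p, ℓ (homogeneousComponent t p) = ℓ p)
    {a b : ℕ} (hab : a + b = t) :
    ∃ (n : ℕ) (u v : Fin n → MvPolynomial σ K),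
      n = finrank K (homogeneousSubmodule σ K a) - finrank K (idealDegree (annIdeal ℓ) a) ∧
      (∀ i, (u i).IsHomogeneous a) ∧ (∀ j, (v j).IsHomogeneous b) ∧
      (∀ i j, ℓ (u i * v j) = if j = i then 1 else 0) ∧
      ∀ w : MvPolynomial σ K, w.IsHomogeneous b → w - ∑ i, ℓ (u i * w) • v i ∈ annIdeal ℓ := by
  classical
  haveI := finite_homogeneousSubmodule (K := K) (σ := σ) a
  haveI := finite_homogeneousSubmodule (K := K) (σ := σ) b
  set φ := gradedMulForm ℓ a b with hφdef
  set N : Submodule K (homogeneousSubmodule σ K a) := LinearMap.ker φ with hNdef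
  set N' : Submodule K (homogeneousSubmodule σ K b) := LinearMap.ker φ.flip with hN'def
  let ψ := quotientPairing φ N N' le_rfl le_rfl
  have hψ : ∀ (x : homogeneousSubmodule σ K a) (y : homogeneousSubmodule σ K b),
      ψ (Submodule.Quotient.mk x) (Submodule.Quotient.mk y) = ℓ ((x : MvPolynomial σ K) * y) := fun x y => by
    change quotientPairing φ N N' le_rfl le_rfl _ _ = _
    rw [quotientPairing_mk, hφdef, gradedMulForm_apply]
  have hinj : Function.Injective ψ := by
    rw [← LinearMap.ker_eq_bot]
    change LinearMap.ker (quotientPairing φ N N' le_rfl le_rfl) = ⊥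
    rw [ker_quotientPairing_eq_map, hNdef, Submodule.mkQ_map_self]
  have hinj' : Function.Injective ψ.flip := by
    rw [← LinearMap.ker_eq_bot, Submodule.eq_bot_iff]
    intro y hy
    obtain ⟨w, rfl⟩ := Submodule.Quotient.mk_surjective N' y
    refine (Submodule.Quotient.mk_eq_zero N').mpr ?_
    rw [hN'def, LinearMap.mem_ker]
    refine LinearMap.ext fun x => ?_
    have h0 := LinearMap.congr_fun (LinearMap.mem_ker.mp hy) (Submodule.Quotient.mk x)
    rw [LinearMap.flip_apply, hψ, LinearMap.zero_apply] at h0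
    rw [LinearMap.flip_apply, LinearMap.zero_apply, hφdef, gradedMulForm_apply]
    exact h0
  haveI hperf : ψ.IsPerfPair := LinearMap.IsPerfPair.of_injective hinj hinj'
  let bW : Basis (Fin (finrank K (homogeneousSubmodule σ K b ⧸ N'))) K (homogeneousSubmodule σ K b ⧸ N') :=
    Module.finBasis K _
  let e : (homogeneousSubmodule σ K a ⧸ N) ≃ₗ[K] Dual K (homogeneousSubmodule σ K b ⧸ N') := ψ.toPerfPair
  let bV : Basis (Fin (finrank K (homogeneousSubmodule σ K b ⧸ N'))) K (homogeneousSubmodule σ K a ⧸ N) :=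
    bW.dualBasis.map e.symm
  have hbV : ∀ (i) (y : homogeneousSubmodule σ K b ⧸ N'), ψ (bV i) y = bW.repr y i := by
    intro i y
    change e (bV i) y = _
    simp only [bV, Basis.map_apply, LinearEquiv.apply_symm_apply, Basis.dualBasis_apply]
  have hbVW : ∀ i j, ψ (bV i) (bW j) = if j = i then 1 else 0 := by
    intro i j
    rw [hbV, bW.repr_self, Finsupp.single_apply]
  have hsurjV : Function.Surjective (N.mkQ : homogeneousSubmodule σ K a → homogeneousSubmodule σ K a ⧸ N) :=
    Submodule.mkQ_surjective N
  have hsurjW : Function.Surjective (N'.mkQ : homogeneousSubmodule σ K b → homogeneousSubmodule σ K b ⧸ N') :=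
    Submodule.mkQ_surjective N'
  let u : Fin (finrank K (homogeneousSubmodule σ K b ⧸ N')) → homogeneousSubmodule σ K a :=
    fun i => Function.surjInv hsurjV (bV i)
  let v : Fin (finrank K (homogeneousSubmodule σ K b ⧸ N')) → homogeneousSubmodule σ K b :=
    fun j => Function.surjInv hsurjW (bW j)
  have hu : ∀ i, Submodule.Quotient.mk (u i) = bV i := fun i => Function.surjInv_eq hsurjV (bV i)
  have hv : ∀ j, Submodule.Quotient.mk (v j) = bW j := fun j => Function.surjInv_eq hsurjW (bW j)
  refine ⟨finrank K (homogeneousSubmodule σ K b ⧸ N'), fun i => (u i : MvPolynomial σ K),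
    fun j => (v j : MvPolynomial σ K), ?_, fun i => (mem_homogeneousSubmodule _ _).mp (u i).2,
    fun j => (mem_homogeneousSubmodule _ _).mp (v j).2, ?_, ?_⟩
  · -- the count `n = dim S_a − dim I_a`
    have h1 : finrank K (homogeneousSubmodule σ K a ⧸ N) = finrank K (homogeneousSubmodule σ K b ⧸ N') :=
      Module.finrank_of_isPerfPair ψ
    have h2 : finrank K (homogeneousSubmodule σ K a ⧸ N) + finrank K N =
        finrank K (homogeneousSubmodule σ K a) := Submodule.finrank_quotient_add_finrank N
    have h3 : finrank K N = finrank K (idealDegree (annIdeal ℓ) a) := by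
      rw [hNdef, hφdef]; exact finrank_ker_gradedMulForm hℓ hab
    have h4 : finrank K (idealDegree (annIdeal ℓ) a) ≤ finrank K (homogeneousSubmodule σ K a) :=
      finrank_idealDegree_le (annIdeal ℓ) a
    omega
  · intro i j
    rw [← hψ, hu, hv, hbVW]
  · intro w hw
    have hw' : w ∈ homogeneousSubmodule σ K b := hw
    have hrepr : ∀ j, ℓ ((u j : MvPolynomial σ K) * w) = bW.repr (Submodule.Quotient.mk ⟨w, hw'⟩) j := by
      intro j
      rw [← hbV, ← hu, hψ]
    have hmk : N'.mkQ ((⟨w, hw'⟩ : homogeneousSubmodule σ K b) - ∑ j, ℓ ((u j : MvPolynomial σ K) * w) • v j) =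
        0 := by
      simp only [map_sub, map_sum, map_smul, Submodule.mkQ_apply, hv, hrepr]
      rw [bW.sum_repr, sub_self]
    rw [Submodule.mkQ_apply, Submodule.Quotient.mk_eq_zero] at hmk
    have hmem : ((⟨w, hw'⟩ : homogeneousSubmodule σ K b) - ∑ j, ℓ ((u j : MvPolynomial σ K) * w) • v j) ∈
        (idealDegree (annIdeal ℓ) b).comap (homogeneousSubmodule σ K b).subtype := by
      rw [← ker_gradedMulForm_flip hℓ hab]
      exact hmk
    rw [Submodule.mem_comap, Submodule.subtype_apply, mem_idealDegree] at hmem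
    have hcoe : (((⟨w, hw'⟩ : homogeneousSubmodule σ K b) - ∑ j, ℓ ((u j : MvPolynomial σ K) * w) • v j :
        homogeneousSubmodule σ K b) : MvPolynomial σ K) =
        w - ∑ j, ℓ ((u j : MvPolynomial σ K) * w) • (v j : MvPolynomial σ K) := by
      simp
    rw [hcoe] at hmem
    exact hmem.1

end GradedDual

/-! ## The count: `h_{Ann(ℓ₁ ⊗ ℓ₂)}(k) = Σ_{p+q=k} h_{Ann ℓ₁}(p) · h_{Ann ℓ₂}(q)` -/

section Join

variable {K : Type*} [Field K] {σ τ : Type*} {t₁ t₂ : ℕ}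
  {ℓ₁ : MvPolynomial σ K →ₗ[K] K} {ℓ₂ : MvPolynomial τ K →ₗ[K] K}

/-- Replacing the `x`-factor modulo `Ann ℓ₁` does not change `(ℓ₁ ⊗ ℓ₂)(g · a(x) · z)`.
[cite: DuqueFrancoVillaflor2025Join, Theorem 1.1 (proof)] -/
theorem tensorFunctional_mul_rename_inl_congr {a a' : MvPolynomial σ K} (h : a - a' ∈ annIdeal ℓ₁)
    (g z : MvPolynomial (σ ⊕ τ) K) :
    tensorFunctional ℓ₁ ℓ₂ (g * (rename Sum.inl a * z)) =
      tensorFunctional ℓ₁ ℓ₂ (g * (rename Sum.inl a' * z)) := by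
  have hmem : (rename Sum.inl (a - a') : MvPolynomial (σ ⊕ τ) K) ∈ annIdeal (tensorFunctional ℓ₁ ℓ₂) :=
    map_rename_inl_annIdeal_le ℓ₁ ℓ₂ (Ideal.mem_map_of_mem _ h)
  rw [← sub_eq_zero, ← map_sub, ← mul_sub, ← sub_mul, ← map_sub, mul_left_comm]
  exact hmem _

/-- … and symmetrically for the `y`-factor modulo `Ann ℓ₂`. [cite: DuqueFrancoVillaflor2025Join, Theorem 1.1 (proof)] -/
theorem tensorFunctional_mul_rename_inr_congr {b b' : MvPolynomial τ K} (h : b - b' ∈ annIdeal ℓ₂)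
    (g y : MvPolynomial (σ ⊕ τ) K) :
    tensorFunctional ℓ₁ ℓ₂ (g * (y * rename Sum.inr b)) =
      tensorFunctional ℓ₁ ℓ₂ (g * (y * rename Sum.inr b')) := by
  have hmem : (rename Sum.inr (b - b') : MvPolynomial (σ ⊕ τ) K) ∈ annIdeal (tensorFunctional ℓ₁ ℓ₂) :=
    map_rename_inr_annIdeal_le ℓ₁ ℓ₂ (Ideal.mem_map_of_mem _ h)
  rw [← sub_eq_zero, ← map_sub, ← mul_sub, ← mul_sub, ← map_sub, ← mul_assoc, mul_comm _ (rename _ _)]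
  exact hmem _

/-- Expanding the `x`-factor along a finite family: `(ℓ₁ ⊗ ℓ₂)(g · (Σ_i c_i v_i)(x) · z) = Σ_i c_i (ℓ₁ ⊗ ℓ₂)(g v_i(x) z)`.
[cite: DuqueFrancoVillaflor2025Join, Theorem 1.1 (proof)] -/
theorem tensorFunctional_mul_sum_rename_inl {n : ℕ} (c : Fin n → K) (v : Fin n → MvPolynomial σ K)
    (g z : MvPolynomial (σ ⊕ τ) K) :
    tensorFunctional ℓ₁ ℓ₂ (g * (rename Sum.inl (∑ i, c i • v i) * z)) =
      ∑ i, c i * tensorFunctional ℓ₁ ℓ₂ (g * (rename Sum.inl (v i) * z)) := by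
  simp [map_sum, Finset.sum_mul, Finset.mul_sum]

/-- … and the `y`-factor. [cite: DuqueFrancoVillaflor2025Join, Theorem 1.1 (proof)] -/
theorem tensorFunctional_mul_sum_rename_inr {n : ℕ} (c : Fin n → K) (v : Fin n → MvPolynomial τ K)
    (g y : MvPolynomial (σ ⊕ τ) K) :
    tensorFunctional ℓ₁ ℓ₂ (g * (y * rename Sum.inr (∑ i, c i • v i))) =
      ∑ i, c i * tensorFunctional ℓ₁ ℓ₂ (g * (y * rename Sum.inr (v i))) := by
  simp [map_sum, Finset.mul_sum]

/-- The degree of an exponent in the support of a form. [folklore] -/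
private theorem degree_eq_of_mem_support {R : Type*} [CommSemiring R] {ι : Type*} {φ : MvPolynomial ι R}
    {n : ℕ} (hφ : φ.IsHomogeneous n) {s : ι →₀ ℕ} (hs : s ∈ φ.support) : s.degree = n := by
  rw [Finsupp.degree_apply, ← hφ.degree_eq_sum_deg_support hs]

variable [Finite σ] [Finite τ]

/-- **Corollary 6.1 (ideal form): the Hilbert function of `S/(Ann ℓ₁·S + Ann ℓ₂·S) = K[x]/Ann ℓ₁ ⊗ K[y]/Ann ℓ₂`
is the convolution** `h(k) = Σ_{p+q=k} h₁(p) h₂(q)` — "`HF_{[J(Z₁,Z₂)]} = HF_{[Z₁]} * HF_{[Z₂]}`" with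
`Ann(ℓ₁ ⊗ ℓ₂) = Ann ℓ₁·S + Ann ℓ₂·S = J^{f+g,[J(Z₁,Z₂)]}` (Thm. 1.1). Here `ℓ_j` are concentrated in degrees `t_j`
and `h_J(k) = dim S_k − dim J_k`. [cite: DuqueFrancoVillaflor2025Join, Corollary 6.1] -/
theorem hilbert_annIdeal_tensorFunctional (hℓ₁ : ∀ p, ℓ₁ (homogeneousComponent t₁ p) = ℓ₁ p)
    (hℓ₂ : ∀ p, ℓ₂ (homogeneousComponent t₂ p) = ℓ₂ p) (k : ℕ) :
    finrank K (homogeneousSubmodule (σ ⊕ τ) K k) -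
        finrank K (idealDegree (annIdeal (tensorFunctional ℓ₁ ℓ₂)) k) =
      conv (fun p => finrank K (homogeneousSubmodule σ K p) - finrank K (idealDegree (annIdeal ℓ₁) p))
        (fun q => finrank K (homogeneousSubmodule τ K q) - finrank K (idealDegree (annIdeal ℓ₂) q)) k := by
  classical
  -- graded dual families for `ℓ₁` in every degree `p` (empty above the socle degree)
  have fam₁ : ∀ p : ℕ, ∃ (n : ℕ) (u v : Fin n → MvPolynomial σ K),
      n = finrank K (homogeneousSubmodule σ K p) - finrank K (idealDegree (annIdeal ℓ₁) p) ∧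
      (∀ i, (u i).IsHomogeneous p) ∧ (∀ j, (v j).IsHomogeneous (t₁ - p)) ∧
      (∀ i j, ℓ₁ (u i * v j) = if j = i then 1 else 0) ∧
      (p ≤ t₁ → ∀ w : MvPolynomial σ K, w.IsHomogeneous (t₁ - p) →
        w - ∑ i, ℓ₁ (u i * w) • v i ∈ annIdeal ℓ₁) := by
    intro p
    by_cases hp : p ≤ t₁
    · obtain ⟨n, u, v, hn, hu, hv, hd, hs⟩ :=
        exists_graded_dual_families hℓ₁ (a := p) (b := t₁ - p) (by omega)
      exact ⟨n, u, v, hn, hu, hv, hd, fun _ => hs⟩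
    · refine ⟨0, Fin.elim0, Fin.elim0, ?_, fun i => i.elim0, fun j => j.elim0, fun i => i.elim0,
        fun h => absurd h hp⟩
      rw [hilbert_annIdeal_eq_zero_of_lt hℓ₁ (by omega)]
  have fam₂ : ∀ q : ℕ, ∃ (n : ℕ) (u v : Fin n → MvPolynomial τ K),
      n = finrank K (homogeneousSubmodule τ K q) - finrank K (idealDegree (annIdeal ℓ₂) q) ∧
      (∀ i, (u i).IsHomogeneous q) ∧ (∀ j, (v j).IsHomogeneous (t₂ - q)) ∧
      (∀ i j, ℓ₂ (u i * v j) = if j = i then 1 else 0) ∧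
      (q ≤ t₂ → ∀ w : MvPolynomial τ K, w.IsHomogeneous (t₂ - q) →
        w - ∑ i, ℓ₂ (u i * w) • v i ∈ annIdeal ℓ₂) := by
    intro q
    by_cases hq : q ≤ t₂
    · obtain ⟨n, u, v, hn, hu, hv, hd, hs⟩ :=
        exists_graded_dual_families hℓ₂ (a := q) (b := t₂ - q) (by omega)
      exact ⟨n, u, v, hn, hu, hv, hd, fun _ => hs⟩
    · refine ⟨0, Fin.elim0, Fin.elim0, ?_, fun i => i.elim0, fun j => j.elim0, fun i => i.elim0,
        fun h => absurd h hq⟩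
      rw [hilbert_annIdeal_eq_zero_of_lt hℓ₂ (by omega)]
  choose n₁ u₁ v₁ hn₁ hu₁ hv₁ hd₁ hs₁ using fam₁
  choose n₂ u₂ v₂ hn₂ hu₂ hv₂ hd₂ hs₂ using fam₂
  -- degrees carrying a non-empty family are `≤` the socle degree
  have hle₁ : ∀ p, Fin (n₁ p) → p ≤ t₁ := fun p i => by
    by_contra H
    have h0 : n₁ p = 0 := by rw [hn₁, hilbert_annIdeal_eq_zero_of_lt hℓ₁ (by omega)]
    exact (Fin.cast h0 i).elim0
  have hle₂ : ∀ q, Fin (n₂ q) → q ≤ t₂ := fun q j => by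
    by_contra H
    have h0 : n₂ q = 0 := by rw [hn₂, hilbert_annIdeal_eq_zero_of_lt hℓ₂ (by omega)]
    exact (Fin.cast h0 j).elim0
  -- the functional `ℓ = ℓ₁ ⊗ ℓ₂`, concentrated in degree `t₁ + t₂`
  set ℓ := tensorFunctional ℓ₁ ℓ₂ with hℓdef
  have hℓ : ∀ p, ℓ (homogeneousComponent (t₁ + t₂) p) = ℓ p := tensorFunctional_homogeneousComponent hℓ₁ hℓ₂
  -- the index set and the test forms
  let Ι := Σ p : Fin (k + 1), Fin (n₁ p) × Fin (n₂ (k - p))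
  let m : Ι → MvPolynomial (σ ⊕ τ) K := fun idx =>
    rename Sum.inl (v₁ idx.1 idx.2.1) * rename Sum.inr (v₂ (k - idx.1) idx.2.2)
  let Ψ : homogeneousSubmodule (σ ⊕ τ) K k →ₗ[K] (Ι → K) :=
    LinearMap.pi fun idx => ℓ ∘ₗ LinearMap.mulRight K (m idx) ∘ₗ (homogeneousSubmodule (σ ⊕ τ) K k).subtype
  have hΨ : ∀ (g : homogeneousSubmodule (σ ⊕ τ) K k) (idx : Ι), Ψ g idx = ℓ ((g : MvPolynomial (σ ⊕ τ) K) * m idx) := by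
    intro g idx
    simp [Ψ, LinearMap.pi_apply]
  -- (1) the kernel of `Ψ` is `I_k`, `I = Ann(ℓ₁ ⊗ ℓ₂)`
  have hker : LinearMap.ker Ψ =
      (idealDegree (annIdeal ℓ) k).comap (homogeneousSubmodule (σ ⊕ τ) K k).subtype := by
    ext g
    rw [LinearMap.mem_ker, Submodule.mem_comap, Submodule.subtype_apply, mem_idealDegree]
    constructor
    · intro hg
      refine ⟨?_, g.2⟩
      have hg' : ∀ idx, ℓ ((g : MvPolynomial (σ ⊕ τ) K) * m idx) = 0 := fun idx => by
        rw [← hΨ, hg, Pi.zero_apply]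
      by_cases hkt : t₁ + t₂ < k
      · exact mem_annIdeal_of_isHomogeneous_of_lt hℓ g.2 hkt
      push Not at hkt
      -- key: `ℓ(g · a(x) b(y)) = 0` for all forms `a`, `b` of complementary total degree
      have key : ∀ (a : MvPolynomial σ K) (b : MvPolynomial τ K) (p' q' : ℕ), a.IsHomogeneous p' →
          b.IsHomogeneous q' → p' + q' + k = t₁ + t₂ →
          ℓ ((g : MvPolynomial (σ ⊕ τ) K) * (rename Sum.inl a * rename Sum.inr b)) = 0 := by
        intro a b p' q' ha hb hsum
        by_cases hp' : t₁ < p'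
        · have hmem : (rename Sum.inl a : MvPolynomial (σ ⊕ τ) K) ∈ annIdeal ℓ :=
            map_rename_inl_annIdeal_le ℓ₁ ℓ₂
              (Ideal.mem_map_of_mem _ (mem_annIdeal_of_isHomogeneous_of_lt hℓ₁ ha hp'))
          rw [mul_left_comm]
          exact hmem _
        by_cases hq' : t₂ < q'
        · have hmem : (rename Sum.inr b : MvPolynomial (σ ⊕ τ) K) ∈ annIdeal ℓ :=
            map_rename_inr_annIdeal_le ℓ₁ ℓ₂
              (Ideal.mem_map_of_mem _ (mem_annIdeal_of_isHomogeneous_of_lt hℓ₂ hb hq'))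
          rw [← mul_assoc, mul_comm _ (rename Sum.inr b)]
          exact hmem _
        push Not at hp' hq'
        -- `p := t₁ − p'`, `q := t₂ − q' = k − p`
        set p := t₁ - p' with hpdef
        have hpk : p ≤ k := by omega
        have hq : t₂ - (k - p) = q' := by omega
        have hkp : k - p ≤ t₂ := by omega
        have ha' : a.IsHomogeneous (t₁ - p) := by rwa [show t₁ - p = p' by omega]
        have hb' : b.IsHomogeneous (t₂ - (k - p)) := by rwa [hq]
        -- expand `a` along `v₁ p`, then `b` along `v₂ (k − p)`
        rw [tensorFunctional_mul_rename_inl_congr (hs₁ p (by omega) a ha'),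
          tensorFunctional_mul_sum_rename_inl]
        refine Finset.sum_eq_zero fun i _ => ?_
        rw [tensorFunctional_mul_rename_inr_congr (hs₂ (k - p) hkp b hb'), tensorFunctional_mul_sum_rename_inr]
        refine mul_eq_zero_of_right _ (Finset.sum_eq_zero fun j _ => mul_eq_zero_of_right _ ?_)
        exact hg' ⟨⟨p, by omega⟩, i, j⟩
      refine mem_annIdeal_of_forall_isHomogeneous hℓ g.2 (b := t₁ + t₂ - k) (by omega) fun h hh => ?_
      rw [h.as_sum, Finset.mul_sum, map_sum]
      refine Finset.sum_eq_zero fun s hs => ?_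
      rw [monomial_eq_rename_mul_rename s (coeff s h)]
      refine key _ _ _ _ (isHomogeneous_monomial _ rfl) (isHomogeneous_monomial _ rfl) ?_
      have hdeg : s.degree = t₁ + t₂ - k := degree_eq_of_mem_support hh hs
      rw [degree_eq_degree_add_degree] at hdeg
      omega
    · rintro ⟨hg, -⟩
      funext idx
      rw [hΨ, Pi.zero_apply]
      exact hg (m idx)
  -- (2) `Ψ` is surjective: it maps `u₁(x) u₂(y)` to the standard basis
  have hsurj : LinearMap.range Ψ = ⊤ := by
    have hsingle : ∀ idx₀ : Ι, Pi.single idx₀ (1 : K) ∈ LinearMap.range Ψ := by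
      rintro ⟨p, i, j⟩
      have hw : (rename Sum.inl (u₁ p i) * rename Sum.inr (u₂ (k - p) j) : MvPolynomial (σ ⊕ τ) K).IsHomogeneous k := by
        have := ((hu₁ p i).rename_isHomogeneous (f := (Sum.inl : σ → σ ⊕ τ))).mul
          ((hu₂ (k - p) j).rename_isHomogeneous (f := (Sum.inr : τ → σ ⊕ τ)))
        rwa [show (p : ℕ) + (k - p) = k by omega] at this
      refine ⟨⟨_, hw⟩, funext fun idx => ?_⟩
      obtain ⟨p', i', j'⟩ := idx
      rw [hΨ]
      change ℓ (rename Sum.inl (u₁ p i) * rename Sum.inr (u₂ (k - p) j) *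
        (rename Sum.inl (v₁ p' i') * rename Sum.inr (v₂ (k - p') j'))) = _
      rw [mul_mul_mul_comm, ← map_mul, ← map_mul, hℓdef, tensorFunctional_mul_rename]
      by_cases hpp : p' = p
      · subst hpp
        rw [hd₁, hd₂, Pi.single_apply]
        by_cases hi : i' = i
        · subst hi
          by_cases hj : j' = j
          · subst hj; simp
          · rw [if_neg hj, mul_zero, if_neg]
            intro H
            exact hj (by cases H; rfl)
        · rw [if_neg hi, zero_mul, if_neg]
          intro H
          exact hi (by cases H; rfl)
      · have hp't : (p' : ℕ) ≤ t₁ := hle₁ p' i'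
        have hpt : (p : ℕ) ≤ t₁ := hle₁ p i
        have hne : (p : ℕ) + (t₁ - p') ≠ t₁ := by
          intro H
          apply hpp
          exact Fin.ext (by omega)
        rw [apply_eq_zero_of_isHomogeneous_ne hℓ₁ ((hu₁ p i).mul (hv₁ p' i')) hne, zero_mul,
          Pi.single_apply, if_neg]
        intro H
        exact hpp (by cases H; rfl)
    refine eq_top_iff.mpr fun f _ => ?_
    rw [← Finset.univ_sum_single f]
    refine Submodule.sum_mem _ fun idx _ => ?_
    have : Pi.single idx (f idx) = f idx • Pi.single idx (1 : K) := by
      rw [← Pi.single_smul, smul_eq_mul, mul_one]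
    rw [this]
    exact Submodule.smul_mem _ _ (hsingle idx)
  -- (3) rank–nullity
  haveI := finite_homogeneousSubmodule (K := K) (σ := σ ⊕ τ) k
  have hrn := LinearMap.finrank_range_add_finrank_ker Ψ
  rw [hsurj, finrank_top, Module.finrank_fintype_fun_eq_card, hker,
    (Submodule.comapSubtypeEquivOfLe (idealDegree_le_homogeneousSubmodule _ _)).finrank_eq] at hrn
  have hcard : Fintype.card Ι = conv
      (fun p => finrank K (homogeneousSubmodule σ K p) - finrank K (idealDegree (annIdeal ℓ₁) p))
      (fun q => finrank K (homogeneousSubmodule τ K q) - finrank K (idealDegree (annIdeal ℓ₂) q)) k := by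
    rw [conv_eq_sum_range, Fintype.card_sigma]
    simp only [Fintype.card_prod, Fintype.card_fin]
    rw [Fin.sum_univ_eq_sum_range (fun p => n₁ p * n₂ (k - p)) (k + 1)]
    refine Finset.sum_congr rfl fun p _ => ?_
    rw [hn₁, hn₂]
  omega

/-- **Corollary 6.1 for Artinian Gorenstein ideals**: for `I₁ ⊆ K[x]`, `I₂ ⊆ K[y]` Artinian Gorenstein,
`h_{I₁·S + I₂·S}(k) = Σ_{p+q=k} h_{I₁}(p)·h_{I₂}(q)` — "`HF_{[J(Z₁,Z₂)]} = HF_{[Z₁]} * HF_{[Z₂]}`" once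
`J^{f+g,[J(Z₁,Z₂)]} = J^{f,[Z₁]}·S + J^{g,[Z₂]}·S` (Thm. 1.1, tree `IsArtinianGorenstein.colon_join`).
[cite: DuqueFrancoVillaflor2025Join, Corollary 6.1] -/
theorem IsArtinianGorenstein.hilbert_join {I₁ : Ideal (MvPolynomial σ K)} {I₂ : Ideal (MvPolynomial τ K)}
    {σ₁ σ₂ : ℕ} (h₁ : IsArtinianGorenstein I₁ σ₁) (h₂ : IsArtinianGorenstein I₂ σ₂) (k : ℕ) :
    finrank K (homogeneousSubmodule (σ ⊕ τ) K k) -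
        finrank K (idealDegree (I₁.map (rename Sum.inl) ⊔ I₂.map (rename Sum.inr) :
          Ideal (MvPolynomial (σ ⊕ τ) K)) k) =
      conv (fun p => finrank K (homogeneousSubmodule σ K p) - finrank K (idealDegree I₁ p))
        (fun q => finrank K (homogeneousSubmodule τ K q) - finrank K (idealDegree I₂ q)) k := by
  obtain ⟨ℓ₁, hℓ₁, -, rfl⟩ := h₁.exists_eq_annIdeal
  obtain ⟨ℓ₂, hℓ₂, -, rfl⟩ := h₂.exists_eq_annIdeal
  rw [← annIdeal_tensorFunctional_of_homogeneousComponent hℓ₂]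
  exact hilbert_annIdeal_tensorFunctional hℓ₁ hℓ₂ k

/-- In particular (Cor. 6.1 + Thm. 1.1 + Def. 2.2): for Artinian Gorenstein `I₁` (socle `σ₁`), `I₂`
(socle `σ₂`) and forms `P ∉ I₁` of degree `e₁ ≤ σ₁`, `Q ∉ I₂` of degree `e₂ ≤ σ₂`, the Hilbert function of
`((I₁·S + I₂·S) : P(x)Q(y)) = (I₁ : P)·S + (I₂ : Q)·S` is the convolution of those of `(I₁ : P)` and `(I₂ : Q)` —
with `I₁ = J^f`, `I₂ = J^g`, `P = P_{Z₁}`, `Q = P_{Z₂}`: "`HF_{[J(Z₁,Z₂)]} = HF_{[Z₁]} * HF_{[Z₂]}`"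
(`HF_λ` = Hilbert function of `S/J^{F,λ}`, `J^{F,λ} = (J^F : P_λ)`, Def. 2.2 / Def. 6.1).
[cite: DuqueFrancoVillaflor2025Join, Corollary 6.1] -/
theorem IsArtinianGorenstein.hilbert_colon_join {I₁ : Ideal (MvPolynomial σ K)}
    {I₂ : Ideal (MvPolynomial τ K)} {σ₁ σ₂ : ℕ} (h₁ : IsArtinianGorenstein I₁ σ₁)
    (h₂ : IsArtinianGorenstein I₂ σ₂) {P : MvPolynomial σ K} {Q : MvPolynomial τ K} {e₁ s₁ e₂ s₂ : ℕ}
    (hP : P.IsHomogeneous e₁) (hes₁ : e₁ + s₁ = σ₁) (hPI : P ∉ I₁) (hQ : Q.IsHomogeneous e₂)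
    (hes₂ : e₂ + s₂ = σ₂) (hQI : Q ∉ I₂) (k : ℕ) :
    finrank K (homogeneousSubmodule (σ ⊕ τ) K k) -
        finrank K (idealDegree ((I₁.map (rename Sum.inl) ⊔ I₂.map (rename Sum.inr) :
          Ideal (MvPolynomial (σ ⊕ τ) K)).colon {rename Sum.inl P * rename Sum.inr Q}) k) =
      conv (fun p => finrank K (homogeneousSubmodule σ K p) - finrank K (idealDegree (I₁.colon {P}) p))
        (fun q => finrank K (homogeneousSubmodule τ K q) - finrank K (idealDegree (I₂.colon {Q}) q)) k := by
  rw [h₁.colon_join h₂]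
  exact (h₁.colon hP hes₁ hPI).hilbert_join (h₂.colon hQ hes₂ hQI) k

/-- **Theorem 1.1, second part, as an equivalence (algebraic form)**: for non-zero functionals `ℓ₁`, `ℓ₂`
concentrated in degrees `t₁`, `t₂` and a non-zero `ℓ` on `K[x ⊔ y]` concentrated in degree `t₁ + t₂`,
`Ann(ℓ) = Ann ℓ₁·S + Ann ℓ₂·S ⟺ ℓ = c·(ℓ₁ ⊗ ℓ₂)` for some `c ≠ 0` — "`R^{f+g,δ} = R^{f,[Z₁]} ⊗ R^{g,[Z₂]} ⟺
δ = c·[J(Z₁,Z₂)]_prim` for some `c ∈ ℚ^×`", read through `δ ↦ ℓ_δ = ℓ_F(· P_δ)` (injective on primitive classes,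
Griffiths — NOT formalised) and `P_{J(Z₁,Z₂)} = P_{Z₁}·P_{Z₂}` (first part — NOT formalised); the step
"(eqjoinAGalg) follows from (rmkeqidealAG)" is the tree's `annIdeal_eq_annIdeal_iff_exists_smul`.
[cite: DuqueFrancoVillaflor2025Join, Theorem 1.1] [cite: DuqueFrancoVillaflor2025Join, Remark 2.1] -/
theorem annIdeal_eq_map_sup_map_iff (hℓ₁ : ∀ p, ℓ₁ (homogeneousComponent t₁ p) = ℓ₁ p)
    (hℓ₂ : ∀ p, ℓ₂ (homogeneousComponent t₂ p) = ℓ₂ p) {ℓ : MvPolynomial (σ ⊕ τ) K →ₗ[K] K}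
    (hℓ : ∀ p, ℓ (homogeneousComponent (t₁ + t₂) p) = ℓ p) (hne : ℓ ≠ 0) :
    annIdeal ℓ = (annIdeal ℓ₁).map (rename Sum.inl) ⊔ (annIdeal ℓ₂).map (rename Sum.inr) ↔
      ∃ c : K, c ≠ 0 ∧ ℓ = c • tensorFunctional ℓ₁ ℓ₂ := by
  rw [← annIdeal_tensorFunctional_of_homogeneousComponent hℓ₂, eq_comm]
  exact annIdeal_eq_annIdeal_iff_exists_smul (tensorFunctional_homogeneousComponent hℓ₁ hℓ₂) hℓ hne

/-- The same for Artinian Gorenstein ideals: `I₁ ⊆ K[x]`, `I₂ ⊆ K[y]` Artinian Gorenstein of socles `σ₁`, `σ₂`,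
with inverse-system generators `ℓ₁`, `ℓ₂`; a non-zero functional `ℓ` concentrated in degree `σ₁ + σ₂` has
`Ann(ℓ) = I₁·S + I₂·S` iff `ℓ = c·(ℓ₁ ⊗ ℓ₂)`, `c ≠ 0`. [cite: DuqueFrancoVillaflor2025Join, Theorem 1.1] -/
theorem annIdeal_eq_map_sup_map_iff_of_eq {I₁ : Ideal (MvPolynomial σ K)} {I₂ : Ideal (MvPolynomial τ K)}
    (hℓ₁ : ∀ p, ℓ₁ (homogeneousComponent t₁ p) = ℓ₁ p) (hI₁ : I₁ = annIdeal ℓ₁)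
    (hℓ₂ : ∀ p, ℓ₂ (homogeneousComponent t₂ p) = ℓ₂ p) (hI₂ : I₂ = annIdeal ℓ₂)
    {ℓ : MvPolynomial (σ ⊕ τ) K →ₗ[K] K} (hℓ : ∀ p, ℓ (homogeneousComponent (t₁ + t₂) p) = ℓ p) (hne : ℓ ≠ 0) :
    annIdeal ℓ = I₁.map (rename Sum.inl) ⊔ I₂.map (rename Sum.inr) ↔
      ∃ c : K, c ≠ 0 ∧ ℓ = c • tensorFunctional ℓ₁ ℓ₂ := by
  subst hI₁ hI₂
  exact annIdeal_eq_map_sup_map_iff hℓ₁ hℓ₂ hℓ hne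

end Join

end Literature.AlgebraicGeometry.DuqueFrancoVillaflor2025

end
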